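import Summits.BirchSwinnertonDyer.BirchSwinnertonDyer.Theorems.AdditiveRankOneBSDpOfExactIndexManin
import Summits.BirchSwinnertonDyer.Rank1Residual.X12.CMRamifiedAdditive
import Summits.BirchSwinnertonDyer.Rank1Residual.X12.O11.RouteUTamagawaCM
import Summits.BirchSwinnertonDyer.Rank1Residual.X11b.SelmerCardParity
import Literature.NumberTheory.EllipticCurves.BSDRankZeroDensity
import Literature.NumberTheory.QuadraticFields.ImaginaryResiduePiForm
import HarnessLib

/-!
# Crux `PrintCFram.BottomClassIndexLawFiveLe` (stmt-BirchSwinnertonDyer-20372), line `eisenstein-resource-bdp-line` (registry v19), stub B1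
# `stub_bsdp_of_classFactor`: THE PRIMITIVITY SOCKET — on the small-Selmer branch, `BSD_p(W)` from the `p`-PRIMITIVITY of a Heegner point
# (LEAD g11 ask (4), STATUS 2026-08-28T22:11:05Z; cell `bsd-print-cfram`, width seat `bsd-line-cfram-p1-w3` g8; `--supports` 20372)

HONEST FRAMING. THEOREMS ONLY (0 defs / 0 facts / 0 sorry); nothing about BSD is proved unconditionally; no stub is closed; no summit
statement is proved by this seat; the crux C2 stays OPEN and is NOT claimed false. This file types BY NAME the statement «B1 on the
small-Selmer branch = Heegner `p`-primitivity» of LEAD g10/g11 and w2 g8 (notes §4 (c)): it is the tree's Manin-robust rank-one descent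
`SchneiderFree.Exact.bsdp_of_exactIndexManin_of_partner_bsdp` (Gross–Zagier I.(6.3)/(7.3), Kolyvagin, GZK, modularity — conjuncts of
`ToricPublishedInputs`) at the point where BOTH index halves are TRIVIAL: when `Ш(W/ℚ)[p] = 0` (the small-Selmer branch, `ParitySplit` §5/§7),
`Ш(W^{(d_K)}/ℚ)[p] = 0` (the Heegner twist is `p`-regular) — so `ord_p #Ш(W/K) = 0` by the EXACT decomposition
`SchneiderFree.exists_shaAn_padicVal_eq_of_heegner_manin` — and the Heegner index carries no `p` beyond the Tamagawa and Manin factors,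
`ord_p [W(K):ℤP] = ord_p ∏c_ℓ(W) + v_p(c)` (on the class `ord_p ∏c_ℓ(W) = 0`, `X12.O11.RouteU.not_dvd_tamagawaProduct_of_hasCM`), the exact index
formula at slack `v_p(c)` holds by arithmetic and the partner's `BSD_p` (`hWd`; on the class it is Burungale–Flach 2024 Cor. 2 for the rank-zero CM
twist, ONE call `EisensteinResourceBdpLine.rankZeroTwistBSDp_of_hasCM hBF hmod W hCM N K Wd hN hK hHN hC hLt` in any consumer that imports the route's
sockets — kept as a hypothesis here so that this module stays ROUTE-INDEPENDENT, no `Theses` import) descends to `BSD_p(W)`.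

* §1 `bsdp_of_heegnerIndex_of_noPTorsion_pair` — generic: `W/ℚ` minimal, `r_an = 1`, odd `p ∣ N`, Heegner datum with `d_K` odd, `p ∤ #𝓞_K^×`,
  `L(W^{(d_K)},1) ≠ 0`, any minimal `Wd ≅ W^{(d_K)}` with `BSDp Wd p`; `Ш(W)[p] = 0`, `Ш(Wd)[p] = 0`,
  `ord_p [W(K):ℤP] = ord_p ∏c_ℓ(W) + v_p(c)` ⊢ `BSDp W p`.
* §2 `bsdp_cmRamified_of_heegnerIndex_of_noPTorsion_twist` — the class form (CM, `p ≥ 5` CM-ramified, `r_an = 1`; `d_K` odd `< −4` so `p ∤ #𝓞_K^×`;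
  `p ∣ N` and `ord_p ∏c_ℓ(W) = 0` are class theorems; `ord_p [W(K):ℤP] = v_p(c)`); `bsdp_cmRamified_of_heegnerIndex_of_natCard_selmerGroup_le_sq` — the
  same with `#Sel_p(W/ℚ) ≤ p²` (Cassels–Tate) in place of `Ш(W)[p] = 0`.
* §3 `padicValNat_index_eq_of_bsdp_pair` — the CONVERSE: `BSD_p(W)`, `BSD_p(Wd)`, `Ш(W)[p] = Ш(Wd)[p] = 0` force `ord_p [W(K):ℤP] = ord_p ∏c_ℓ(W) + v_p(c)`;
  hence `bsdp_iff_heegnerIndex_cmRamified`: on the class, on the branch `Ш(W)[p] = 0` with a `p`-regular Heegner twist, **`BSDp W p ↔ ord_p [W(K″):ℤP_{K″}] = v_p(c)`**.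

The «regular twist» input is carried as `Ш(Wd)[p] = 0` (dischargeable by the (α) rank-zero twin of the level dictionary from a unit field factor, or per
class by a descent certificate). CONDITIONAL on the named facts as hypotheses. References: Gross–Zagier 1986 I.(6.3), V.§2; Jetchev–Skinner–Wan 2017
§7.4.1; Burungale–Flach 2024 Cor. 2; Miller 2011 Def. 1.1; crux workfiles `Lines/eisenstein-resource-bdp-line-w2g8-notes.md` §4, `…-lead-g10.md` §2.
-/

set_option autoImplicit false
-- `…BirchSwinnertonDyer.BirchSwinnertonDyer.Theorems…` is the problem's mandated namespace (D-0017).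
set_option linter.dupNamespace false

noncomputable section

open scoped Classical

namespace Summit.BirchSwinnertonDyer.BirchSwinnertonDyer.Theorems.PrintCFram.ParitySplit

open WeierstrassCurve NumberField IsDedekindDomain
  Literature.NumberTheory.EllipticCurves
  Literature.NumberTheory.EllipticCurves.ModularForms
  Literature.NumberTheory.EllipticCurves.Rank1Residual
  Literature.NumberTheory.EllipticCurves.Rank1Residual.Typed
  Summit.BirchSwinnertonDyer.Rank1Residual
  Summit.BirchSwinnertonDyer.BirchSwinnertonDyer.Theorems
  Summit.BirchSwinnertonDyer.BirchSwinnertonDyer.Theorems.SchneiderFree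

/-! ## §1 Generic: trivial index halves from `Ш(W)[p] = Ш(Wd)[p] = 0` and the index hypothesis -/

/-- **`BSD_p(E)` from the `p`-primitivity of the Heegner point, on the branch `Ш(E)[p] = 0` with a `p`-regular twist.** For `E/ℚ` (minimal `W`)
with `r_an = 1`, an odd `p ∣ N`, a Heegner datum `(N, K, Dt, H, ι, P)` with `d_K` odd, `p ∤ #𝓞_K^×`, `L(E^{d_K},1) ≠ 0`, any minimal model `Wd` of the
twist with `BSD_p(Wd)`: if `Ш(E/ℚ)[p] = 0`, `Ш(Wd/ℚ)[p] = 0` and `ord_p [E(K):ℤP] = ord_p ∏c_ℓ(E) + v_p(c)`, then `BSD_p(E)`. Proof: the EXACT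
decomposition `ord_p #Ш(E/K) = ord_p #Ш(E/ℚ) + ord_p #Ш(E^{d_K}/ℚ)` (`SchneiderFree.exists_shaAn_padicVal_eq_of_heegner_manin`) gives `ord_p #Ш(E/K) = 0`, so both
index halves at slack `v_p(c)` hold by arithmetic; then `SchneiderFree.Exact.bsdp_of_exactIndexManin_of_partner_bsdp`. Facts by name as hypotheses.
[cite: GrossZagier1986, Thm. I.(6.3) and V.§2 (pp. 310–312)] [cite: JetchevSkinnerWan2017, §7.4.1 (arXiv:1512.06894 p. 30)] [cite: Miller2011LMS, §1 and Def. 1.1] -/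
theorem bsdp_of_heegnerIndex_of_noPTorsion_pair
    (hGZ : ∀ (N : ℕ) [NeZero N] (W : WeierstrassCurve ℚ) (K : Type) [Field K] [NumberField K], gross_zagier N W K)
    (hKo : ∀ (N : ℕ) [NeZero N] (W : WeierstrassCurve ℚ) (K : Type) [Field K] [NumberField K], kolyvagin N W K)
    (hGZK : rank_eq_analyticRank_of_analyticRank_le_one) (hmod : hasEntireLFunction_rat) (hGZ73 : GrossZagier1986_thm_I_7_3)
    (W : WeierstrassCurve ℚ) [W.IsElliptic] [W.IsGloballyMinimal] (p : ℕ) [Fact p.Prime]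
    (N : ℕ) [NeZero N] (K : Type) [Field K] [NumberField K]
    (Dt : ModularParametrizationData W N) (H : HeegnerDatum N (NumberField.discr K)) (ι : K →+* ℂ)
    (P : (W.baseChange K).toAffine.Point) (Wd : WeierstrassCurve ℚ) [Wd.IsElliptic] [Wd.IsGloballyMinimal]
    (hr : W.analyticRank = 1) (hN : W.conductorNorm ℤ = N) (hpN : p ∣ N) (hK : IsImaginaryQuadratic K)
    (hodd : Odd (NumberField.discr K)) (hw : ¬ p ∣ Units.torsionOrder K) (hHH : SatisfiesHeegnerHypothesis N K)
    (hLd : (W.quadraticTwist (NumberField.discr K : ℚ)).entireLFunction 1 ≠ 0)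
    (hP : WeierstrassCurve.Affine.Point.map ι.toRatAlgHom P = heegnerPointComplex Dt H)
    (hC : ∃ C : VariableChange ℚ, C • W.quadraticTwist (NumberField.discr K : ℚ) = Wd) (hp2 : p ≠ 2)
    (h0 : ∀ x : W.sha, (p : ℤ) • x = 0 → x = 0) (h0d : ∀ x : Wd.sha, (p : ℤ) • x = 0 → x = 0)
    (hidx : padicValNat p (AddSubgroup.zmultiples P).index = padicValNat p W.tamagawaProduct + padicValNat p Dt.c.natAbs)
    (hWd : BSDp Wd p) : BSDp W p := by
  obtain ⟨Cd, hCd⟩ := hC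
  have hD0 : (NumberField.discr K : ℚ) ≠ 0 := by exact_mod_cast NumberField.discr_ne_zero K
  haveI : (W.quadraticTwist (NumberField.discr K : ℚ)).IsElliptic := W.isElliptic_quadraticTwist hD0
  -- the twist's algebraic central value (a datum for the bookkeeping identity)
  obtain ⟨qd, hqd⟩ := SchneiderFree.exists_rat_twist_L_one_div_realPeriod_of_heegner W N K Dt H ι P (hGZ N W K) (hKo N W K)
    hGZK hmod hGZ73 hK hHH hP hr hLd Wd Cd hCd
  -- finiteness of `Ш(W)`, `Ш(W/K)` and the exact decomposition `ord_p #Ш(W/K) = ord_p #Ш(W) + ord_p #Ш(Wd)`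
  obtain ⟨hfinW, -, hsha, -⟩ := SchneiderFree.exists_shaAn_padicVal_eq_of_heegner_manin W p N K Dt H ι P (hGZ N W K)
    (hKo N W K) hGZK hmod hK hHH hP hp2 hw hr hLd Wd Cd hCd qd hqd
  have hLd1 : Wd.entireLFunction 1 ≠ 0 := by rw [← hCd, entireLFunction_smul]; exact hLd
  have hrd : Wd.analyticRank = 0 := analyticRank_eq_zero_of_entireLFunction_one_ne_zero Wd hLd1
  obtain ⟨-, hfind⟩ := hGZK Wd (by rw [hrd]; exact zero_le_one)
  have hW0 : padicValNat p W.shaOrder = 0 := padicValNat_shaOrder_eq_zero_of_noPTorsion W p hfinW h0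
  have hWd0 : padicValNat p Wd.shaOrder = 0 := padicValNat_shaOrder_eq_zero_of_noPTorsion Wd p hfind h0d
  have hK0 : padicValNat p (W.baseChange K).shaOrder = 0 := by rw [hsha, hW0, hWd0]
  -- both index halves at slack `v_p(c)` by arithmetic
  have hlo : IndexLowerBoundLeAt W p K P (padicValNat p Dt.c.natAbs) := by
    unfold IndexLowerBoundLeAt; omega
  have hup : Upper.IndexUpperBoundLeAt W p K P (padicValNat p Dt.c.natAbs) := by
    unfold Upper.IndexUpperBoundLeAt; omega
  exact SchneiderFree.Exact.bsdp_of_exactIndexManin_of_partner_bsdp hGZ hKo hGZK hmod hGZ73 W p N K Dt H ι P Wd hr hN hpN hK hodd hw hHH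
    hLd hP ⟨Cd, hCd⟩ hp2 hlo hup hWd

/-! ## §2 The class form: CM, `p ≥ 5` CM-ramified, `r_an = 1`; partner's `BSD_p` by Burungale–Flach; `ord_p [W(K):ℤP] = v_p(c)` -/

/-- **PRIMITIVITY SOCKET (class form, Ш-language).** For a class member (`W/ℚ` minimal with CM, `p ≥ 5` CM-ramified, `r_an(W) = 1`) on the branch
`Ш(W)[p] = 0`, an imaginary quadratic `K` Heegner for `N_W` with `d_K` odd `< −4` and `L(W^{(d_K)},1) ≠ 0`, its Heegner point `P ∈ W(K)` for a
parametrisation datum `Dt` (constant `c`), and any minimal model `Wd` of the twist with `Ш(Wd)[p] = 0` (the twist is `p`-REGULAR): if the Heegner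
index is `p`-primitive up to the Manin constant, `ord_p [W(K):ℤP] = v_p(c)`, then `BSD_p(W)`. Inputs: `ToricPublishedInputs` (Gross–Zagier I.(6.3),
Kolyvagin, GZK, modularity, Gross–Zagier I.(7.3) — as the five binders) and the partner's `BSD_p` (`hWd`: on the class, Burungale–Flach 2024 Cor. 2 via
`EisensteinResourceBdpLine.rankZeroTwistBSDp_of_hasCM`); `ord_p ∏c_ℓ(W) = 0` and `p ∤ #𝓞_K^×` are class theorems (`X12.O11.RouteU.not_dvd_tamagawaProduct_of_hasCM`,
`d_K < −4`). This is w2 g8's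
`ParitySplit.bsdp_of_natCard_selmerGroup_le_sq` with its `p ∤ #Ш_an(W)` hypothesis DISCHARGED from the Heegner index. CONDITIONAL; closes no stub.
[cite: GrossZagier1986, Thm. I.(6.3) and V.§2 (pp. 310–312)] [cite: BurungaleFlach2024, Thm. 1.1 and Cor. 2] [cite: JetchevSkinnerWan2017, §7.4.1 (arXiv:1512.06894 p. 30)] -/
theorem bsdp_cmRamified_of_heegnerIndex_of_noPTorsion_twist {p : ℕ} [Fact p.Prime]
    (hGZ : ∀ (N : ℕ) [NeZero N] (W : WeierstrassCurve ℚ) (K : Type) [Field K] [NumberField K], gross_zagier N W K)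
    (hKo : ∀ (N : ℕ) [NeZero N] (W : WeierstrassCurve ℚ) (K : Type) [Field K] [NumberField K], kolyvagin N W K)
    (hGZK : rank_eq_analyticRank_of_analyticRank_le_one) (hmod : hasEntireLFunction_rat) (hGZ73 : GrossZagier1986_thm_I_7_3)
    (W : WeierstrassCurve ℚ) [W.IsElliptic] [W.IsGloballyMinimal] (hCM : W.HasCM) (hram : CMRamified W p) (h5 : 5 ≤ p)
    (hr : W.analyticRank = 1)
    (N : ℕ) [NeZero N] (K : Type) [Field K] [NumberField K]
    (Dt : ModularParametrizationData W N) (H : HeegnerDatum N (NumberField.discr K)) (ι : K →+* ℂ)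
    (P : (W.baseChange K).toAffine.Point) (Wd : WeierstrassCurve ℚ) [Wd.IsElliptic] [Wd.IsGloballyMinimal]
    (hN : W.conductorNorm ℤ = N) (hK : IsImaginaryQuadratic K) (hHN : SatisfiesHeegnerHypothesis N K)
    (hodd : Odd (NumberField.discr K)) (hd4 : NumberField.discr K < -4)
    (hLt : (W.quadraticTwist (NumberField.discr K : ℚ)).entireLFunction 1 ≠ 0)
    (hP : WeierstrassCurve.Affine.Point.map ι.toRatAlgHom P = heegnerPointComplex Dt H)
    (hC : ∃ C : VariableChange ℚ, C • W.quadraticTwist (NumberField.discr K : ℚ) = Wd)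
    (h0 : ∀ x : W.sha, (p : ℤ) • x = 0 → x = 0) (h0d : ∀ x : Wd.sha, (p : ℤ) • x = 0 → x = 0)
    (hidx : padicValNat p (AddSubgroup.zmultiples P).index = padicValNat p Dt.c.natAbs) (hWd : BSDp Wd p) :
    BSDp W p := by
  have hp : p.Prime := Fact.out
  have hp2 : p ≠ 2 := by omega
  have hpN : p ∣ N := by
    rw [← hN]
    exact (W.dvd_conductorNorm_iff_not_hasGoodReductionAtPrime p).mpr (X12.not_good_of_cmRamified W p hCM hp2 hram)
  -- `p ∤ #𝓞_K^×` (`d_K < −4`)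
  have hw : ¬ p ∣ Units.torsionOrder K := by
    rw [Literature.NumberTheory.QuadraticFields.Quadratic.torsionOrder_eq_two_of_discr_lt_neg_four hK.1 hd4]
    intro h
    exact hp2 ((Nat.prime_dvd_prime_iff_eq hp Nat.prime_two).mp h)
  -- the Tamagawa term vanishes on the class (no multiplicative prime, `c_ℓ ≤ 4 < p`)
  have htam : padicValNat p W.tamagawaProduct = 0 :=
    padicValNat.eq_zero_of_not_dvd (X12.O11.RouteU.not_dvd_tamagawaProduct_of_hasCM W hCM p hp h5)
  exact bsdp_of_heegnerIndex_of_noPTorsion_pair hGZ hKo hGZK hmod hGZ73 W p N K Dt H ι P Wd hr hN hpN hK hodd hw hHN hLt hP hC hp2 h0 h0d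
    (by rw [hidx, htam, zero_add]) hWd

/-- **PRIMITIVITY SOCKET (class form, Selmer-language).** The same with the small-Selmer hypothesis `#Sel^{(p)}(W/ℚ) ≤ p²` in place of
`Ш(W)[p] = 0`, granting the Cassels–Tate pairing (`hCT`: the `p`-rank of `Ш[p]` is even, `X11b.noPTorsion_of_card_selmerGroup_lt_of_casselsTate`; GZK gives
`rank = r_an = 1` and `Ш` finite). [cite: Cassels1962ArithmeticIV] [cite: GrossZagier1986, Thm. I.(6.3) and V.§2 (pp. 310–312)] [cite: BurungaleFlach2024, Thm. 1.1 and Cor. 2] -/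
theorem bsdp_cmRamified_of_heegnerIndex_of_natCard_selmerGroup_le_sq {p : ℕ} [hp : Fact p.Prime]
    (hGZ : ∀ (N : ℕ) [NeZero N] (W : WeierstrassCurve ℚ) (K : Type) [Field K] [NumberField K], gross_zagier N W K)
    (hKo : ∀ (N : ℕ) [NeZero N] (W : WeierstrassCurve ℚ) (K : Type) [Field K] [NumberField K], kolyvagin N W K)
    (hGZK : rank_eq_analyticRank_of_analyticRank_le_one) (hmod : hasEntireLFunction_rat) (hGZ73 : GrossZagier1986_thm_I_7_3)
    (hCT : exists_casselsTate_pairing (K := ℚ))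
    (W : WeierstrassCurve ℚ) [W.IsElliptic] [W.IsGloballyMinimal] (hCM : W.HasCM) (hram : CMRamified W p) (h5 : 5 ≤ p)
    (hr : W.analyticRank = 1)
    (N : ℕ) [NeZero N] (K : Type) [Field K] [NumberField K]
    (Dt : ModularParametrizationData W N) (H : HeegnerDatum N (NumberField.discr K)) (ι : K →+* ℂ)
    (P : (W.baseChange K).toAffine.Point) (Wd : WeierstrassCurve ℚ) [Wd.IsElliptic] [Wd.IsGloballyMinimal]
    (hN : W.conductorNorm ℤ = N) (hK : IsImaginaryQuadratic K) (hHN : SatisfiesHeegnerHypothesis N K)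
    (hodd : Odd (NumberField.discr K)) (hd4 : NumberField.discr K < -4)
    (hLt : (W.quadraticTwist (NumberField.discr K : ℚ)).entireLFunction 1 ≠ 0)
    (hP : WeierstrassCurve.Affine.Point.map ι.toRatAlgHom P = heegnerPointComplex Dt H)
    (hC : ∃ C : VariableChange ℚ, C • W.quadraticTwist (NumberField.discr K : ℚ) = Wd)
    (hsel : Nat.card (W.selmerGroup (p : ℤ)) ≤ p ^ 2) (h0d : ∀ x : Wd.sha, (p : ℤ) • x = 0 → x = 0)
    (hidx : padicValNat p (AddSubgroup.zmultiples P).index = padicValNat p Dt.c.natAbs) (hWd : BSDp Wd p) :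
    BSDp W p := by
  -- `#Sel_p ≤ p²` ⟹ `Ш(W)[p] = 0` (Cassels–Tate parity in rank one)
  obtain ⟨hrank, hfin⟩ := hGZK W hr.le
  haveI : Finite W.sha := hfin
  obtain ⟨k, hk⟩ := exists_natCard_selmerGroup_eq_pow W p
  have hk2 : k ≤ 2 := by
    rw [hk] at hsel
    exact (Nat.pow_le_pow_iff_right hp.out.one_lt).mp hsel
  have h0 : ∀ x : W.sha, (p : ℤ) • x = 0 → x = 0 :=
    X11b.noPTorsion_of_card_selmerGroup_lt_of_casselsTate W hCT p hk (by rw [hrank, hr]; omega)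
  exact bsdp_cmRamified_of_heegnerIndex_of_noPTorsion_twist hGZ hKo hGZK hmod hGZ73 W hCM hram h5 hr N K Dt H ι P Wd hN hK hHN hodd hd4 hLt hP
    hC h0 h0d hidx hWd


/-! ## §3 The converse: `BSD_p` of the pair forces the index identity; the IFF on the class -/

/-- **`BSD_p(E)` and `BSD_p(Wd)` FORCE the index identity** on the branch `Ш(E)[p] = Ш(Wd)[p] = 0`: with the data of §1,
`ord_p [E(K):ℤP] = ord_p ∏c_ℓ(E) + v_p(c)`. Proof: Miller's last clause for `E` and `Wd` gives `ord_p #Ш_an(E) = ord_p #Ш(E) = 0` and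
`ord_p #Ш_an(Wd) = 0` with `#Ш_an(Wd) = (L(Wd,1)/Ω)·#Wd(ℚ)²/∏c_ℓ(Wd)` (`Wuthrich2014.shaAn_eq_of_L_one_div_eq`); substitute into the bookkeeping identity
`SchneiderFree.exists_shaAn_padicVal_eq_of_heegner_manin` and use the two transports as equalities (`X2.padicValNat_tamagawaProduct_twist_of_heegner_of_odd`,
`AdditivePotMult.padicValRat_u_eq_zero_of_twist_minimal_of_split`). So on this branch the index identity is not only sufficient (§1) but NECESSARY for BSD_p.
[cite: GrossZagier1986, Thm. I.(6.3) and V.§2 (pp. 310–312)] [cite: JetchevSkinnerWan2017, §7.4.1 (arXiv:1512.06894 p. 30)] [cite: Miller2011LMS, §1 and Def. 1.1] -/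
theorem padicValNat_index_eq_of_bsdp_pair
    (hGZ : ∀ (N : ℕ) [NeZero N] (W : WeierstrassCurve ℚ) (K : Type) [Field K] [NumberField K], gross_zagier N W K)
    (hKo : ∀ (N : ℕ) [NeZero N] (W : WeierstrassCurve ℚ) (K : Type) [Field K] [NumberField K], kolyvagin N W K)
    (hGZK : rank_eq_analyticRank_of_analyticRank_le_one) (hmod : hasEntireLFunction_rat) (hGZ73 : GrossZagier1986_thm_I_7_3)
    (W : WeierstrassCurve ℚ) [W.IsElliptic] [W.IsGloballyMinimal] (p : ℕ) [Fact p.Prime]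
    (N : ℕ) [NeZero N] (K : Type) [Field K] [NumberField K]
    (Dt : ModularParametrizationData W N) (H : HeegnerDatum N (NumberField.discr K)) (ι : K →+* ℂ)
    (P : (W.baseChange K).toAffine.Point) (Wd : WeierstrassCurve ℚ) [Wd.IsElliptic] [Wd.IsGloballyMinimal]
    (hr : W.analyticRank = 1) (hN : W.conductorNorm ℤ = N) (hpN : p ∣ N) (hK : IsImaginaryQuadratic K)
    (hodd : Odd (NumberField.discr K)) (hw : ¬ p ∣ Units.torsionOrder K) (hHH : SatisfiesHeegnerHypothesis N K)
    (hLd : (W.quadraticTwist (NumberField.discr K : ℚ)).entireLFunction 1 ≠ 0)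
    (hP : WeierstrassCurve.Affine.Point.map ι.toRatAlgHom P = heegnerPointComplex Dt H)
    (hC : ∃ C : VariableChange ℚ, C • W.quadraticTwist (NumberField.discr K : ℚ) = Wd) (hp2 : p ≠ 2)
    (h0 : ∀ x : W.sha, (p : ℤ) • x = 0 → x = 0) (h0d : ∀ x : Wd.sha, (p : ℤ) • x = 0 → x = 0)
    (hW : BSDp W p) (hWd : BSDp Wd p) :
    padicValNat p (AddSubgroup.zmultiples P).index = padicValNat p W.tamagawaProduct + padicValNat p Dt.c.natAbs := by
  have hpp : p.Prime := Fact.out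
  obtain ⟨Cd, hCd⟩ := hC
  have hD0 : (NumberField.discr K : ℚ) ≠ 0 := by exact_mod_cast NumberField.discr_ne_zero K
  haveI : (W.quadraticTwist (NumberField.discr K : ℚ)).IsElliptic := W.isElliptic_quadraticTwist hD0
  obtain ⟨qd, hqd⟩ := SchneiderFree.exists_rat_twist_L_one_div_realPeriod_of_heegner W N K Dt H ι P (hGZ N W K) (hKo N W K)
    hGZK hmod hGZ73 hK hHH hP hr hLd Wd Cd hCd
  obtain ⟨hfinW, -, -, q, hq, hval⟩ := SchneiderFree.exists_shaAn_padicVal_eq_of_heegner_manin W p N K Dt H ι P (hGZ N W K)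
    (hKo N W K) hGZK hmod hK hHH hP hp2 hw hr hLd Wd Cd hCd qd hqd
  -- `ord_p #Ш_an(W) = 0`
  haveI : Finite W.sha := hfinW
  obtain ⟨q', hq', hv'⟩ := missingPPartAt_of_bsdp W p hW
  have hqq : q' = q := by exact_mod_cast hq'.symm.trans hq
  subst hqq
  have hvq : padicValRat p q' = 0 := by
    rw [hv', padicValNat_shaOrder_eq_zero_of_noPTorsion W p hfinW h0, Nat.cast_zero]
  -- `ord_p #Ш_an(Wd) = 0` and `#Ш_an(Wd) = qd·#Wd(ℚ)²/∏c_ℓ(Wd)`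
  have hLd1 : Wd.entireLFunction 1 ≠ 0 := by rw [← hCd, entireLFunction_smul]; exact hLd
  obtain ⟨-, hfinPt, hfind, hshaAnd⟩ := Wuthrich2014.shaAn_eq_of_L_one_div_eq hGZK Wd hLd1 hqd
  haveI := hfinPt
  haveI := hfind
  obtain ⟨q'', hq'', hv''⟩ := missingPPartAt_of_bsdp Wd p hWd
  have hv''0 : padicValRat p q'' = 0 := by
    rw [hv'', padicValNat_shaOrder_eq_zero_of_noPTorsion Wd p hfind h0d, Nat.cast_zero]
  have hqq'' : q'' = qd * (Nat.card Wd.toAffine.Point : ℚ) ^ 2 / (Wd.tamagawaProduct : ℚ) := by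
    exact_mod_cast hq''.symm.trans hshaAnd
  have htdeq : Wd.torsionOrder = Nat.card Wd.toAffine.Point := Wd.torsionOrder_eq_natCard_of_finite
  have hqd0 : qd ≠ 0 := by
    intro hz
    apply hLd1
    have hΩ : (Wd.realPeriodRat : ℂ) ≠ 0 := by exact_mod_cast Wd.realPeriodRat_pos_holds.ne'
    rw [hz, Rat.cast_zero, div_eq_zero_iff] at hqd
    exact hqd.resolve_right hΩ
  have htd0 : (Nat.card Wd.toAffine.Point : ℚ) ≠ 0 := by exact_mod_cast (Nat.card_pos).ne'
  have hcd0 : (Wd.tamagawaProduct : ℚ) ≠ 0 := by exact_mod_cast Wd.tamagawaProduct_pos_holds.ne'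
  have hvd : padicValRat p (qd * (Nat.card Wd.toAffine.Point : ℚ) ^ 2 / (Wd.tamagawaProduct : ℚ)) =
      padicValRat p qd + 2 * padicValNat p Wd.torsionOrder - padicValNat p Wd.tamagawaProduct := by
    rw [padicValRat.div (mul_ne_zero hqd0 (pow_ne_zero _ htd0)) hcd0, padicValRat.mul hqd0 (pow_ne_zero _ htd0),
      padicValRat.pow, padicValRat.of_nat, padicValRat.of_nat, htdeq]
    push_cast; ring
  rw [hqq''] at hv''0
  rw [hvd] at hv''0
  -- the two transports, as EQUALITIES (`p` odd, `p ∣ N` split in `K`)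
  have hHN' : SatisfiesHeegnerHypothesis (W.conductorNorm ℤ) K := by rw [hN]; exact hHH
  have hHp : SatisfiesHeegnerHypothesis p K := SatisfiesHeegnerHypothesis.of_dvd hpN hHH
  have hpd : ¬ (p : ℤ) ∣ NumberField.discr K :=
    X11b.Three.not_dvd_discr_of_ncard_primesOver_eq_two hK.1 hp2 (hHH p hpp hpN)
  have htam := X2.padicValNat_tamagawaProduct_twist_of_heegner_of_odd W p hp2 K hK hodd hpd hHN' Cd hCd
  have hu := AdditivePotMult.padicValRat_u_eq_zero_of_twist_minimal_of_split W p K hK hHp Cd hCd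
  -- combine
  have e3 : (padicValNat p Wd.tamagawaProduct : ℤ) = padicValNat p W.tamagawaProduct := by exact_mod_cast htam
  have key : (2 * padicValNat p (AddSubgroup.zmultiples P).index : ℤ) =
      2 * (padicValNat p W.tamagawaProduct + padicValNat p Dt.c.natAbs) := by
    linarith
  have key' : 2 * padicValNat p (AddSubgroup.zmultiples P).index = 2 * (padicValNat p W.tamagawaProduct + padicValNat p Dt.c.natAbs) := by
    exact_mod_cast key
  omega

/-- **THE IFF ON THE CLASS: on the small-Selmer branch with a `p`-regular Heegner twist, `BSD_p(W)` IS Heegner `p`-primitivity (up to the Manin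
constant).** For a class member (`W/ℚ` minimal with CM, `p ≥ 5` CM-ramified, `r_an(W) = 1`) with `Ш(W)[p] = 0`, a Heegner `K` (`d_K` odd `< −4`,
`L(W^{(d_K)},1) ≠ 0`) with Heegner point `P` for the datum `Dt` (constant `c`), and any minimal model `Wd` of the twist with `Ш(Wd)[p] = 0`:
`BSDp W p ↔ ord_p [W(K):ℤP] = v_p(c)`. Inputs: the five `ToricPublishedInputs` binders and the partner's `BSD_p` (`hWd`, Burungale–Flach on the class);
`ord_p ∏c_ℓ(W) = 0` on the class. This is
«B1 ∩ {Ш(W)[p] = 0} = Heegner p-PRIMITIVITY» BY NAME (LEAD g10 report §2(e), w2 g8 notes §4 (c)); with `ParitySplit.natCard_selmerGroup_le_sq_iff_noPTorsion` the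
branch is `#Sel_p(W/ℚ) ≤ p²`. CONDITIONAL on the named facts; closes no stub; BSD is not proved by any of this.
[cite: GrossZagier1986, Thm. I.(6.3) and V.§2 (pp. 310–312)] [cite: BurungaleFlach2024, Thm. 1.1 and Cor. 2] [cite: BurungaleKobayashiNakamuraOta2026, §1.4 (arXiv:2608.06879 p. 8)] -/
theorem bsdp_iff_heegnerIndex_cmRamified {p : ℕ} [Fact p.Prime]
    (hGZ : ∀ (N : ℕ) [NeZero N] (W : WeierstrassCurve ℚ) (K : Type) [Field K] [NumberField K], gross_zagier N W K)
    (hKo : ∀ (N : ℕ) [NeZero N] (W : WeierstrassCurve ℚ) (K : Type) [Field K] [NumberField K], kolyvagin N W K)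
    (hGZK : rank_eq_analyticRank_of_analyticRank_le_one) (hmod : hasEntireLFunction_rat) (hGZ73 : GrossZagier1986_thm_I_7_3)
    (W : WeierstrassCurve ℚ) [W.IsElliptic] [W.IsGloballyMinimal] (hCM : W.HasCM) (hram : CMRamified W p) (h5 : 5 ≤ p)
    (hr : W.analyticRank = 1)
    (N : ℕ) [NeZero N] (K : Type) [Field K] [NumberField K]
    (Dt : ModularParametrizationData W N) (H : HeegnerDatum N (NumberField.discr K)) (ι : K →+* ℂ)
    (P : (W.baseChange K).toAffine.Point) (Wd : WeierstrassCurve ℚ) [Wd.IsElliptic] [Wd.IsGloballyMinimal]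
    (hN : W.conductorNorm ℤ = N) (hK : IsImaginaryQuadratic K) (hHN : SatisfiesHeegnerHypothesis N K)
    (hodd : Odd (NumberField.discr K)) (hd4 : NumberField.discr K < -4)
    (hLt : (W.quadraticTwist (NumberField.discr K : ℚ)).entireLFunction 1 ≠ 0)
    (hP : WeierstrassCurve.Affine.Point.map ι.toRatAlgHom P = heegnerPointComplex Dt H)
    (hC : ∃ C : VariableChange ℚ, C • W.quadraticTwist (NumberField.discr K : ℚ) = Wd)
    (h0 : ∀ x : W.sha, (p : ℤ) • x = 0 → x = 0) (h0d : ∀ x : Wd.sha, (p : ℤ) • x = 0 → x = 0) (hWd : BSDp Wd p) :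
    BSDp W p ↔ padicValNat p (AddSubgroup.zmultiples P).index = padicValNat p Dt.c.natAbs := by
  have hp : p.Prime := Fact.out
  have hp2 : p ≠ 2 := by omega
  refine ⟨fun hW ↦ ?_, fun hidx ↦ bsdp_cmRamified_of_heegnerIndex_of_noPTorsion_twist hGZ hKo hGZK hmod hGZ73 W hCM hram h5 hr N K Dt
    H ι P Wd hN hK hHN hodd hd4 hLt hP hC h0 h0d hidx hWd⟩
  have hpN : p ∣ N := by
    rw [← hN]
    exact (W.dvd_conductorNorm_iff_not_hasGoodReductionAtPrime p).mpr (X12.not_good_of_cmRamified W p hCM hp2 hram)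
  have hw : ¬ p ∣ Units.torsionOrder K := by
    rw [Literature.NumberTheory.QuadraticFields.Quadratic.torsionOrder_eq_two_of_discr_lt_neg_four hK.1 hd4]
    intro h
    exact hp2 ((Nat.prime_dvd_prime_iff_eq hp Nat.prime_two).mp h)
  have htam : padicValNat p W.tamagawaProduct = 0 :=
    padicValNat.eq_zero_of_not_dvd (X12.O11.RouteU.not_dvd_tamagawaProduct_of_hasCM W hCM p hp h5)
  have key := padicValNat_index_eq_of_bsdp_pair hGZ hKo hGZK hmod hGZ73 W p N K Dt H ι P Wd hr hN hpN hK hodd hw hHN hLt hP hC hp2 h0 h0d hW hWd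
  rw [key, htam, zero_add]

/-! ## §4 (appended) The «regular twist» binder from a Selmer bound: `#Sel_p(Wd/ℚ) ≤ p` in analytic rank ZERO ⟹ `Ш(Wd)[p] = 0` -/

/-- **`Ш(E/ℚ)[p] = 0` from `#Sel^{(p)}(E/ℚ) ≤ p` in analytic rank ZERO** (Cassels–Tate parity: `#Sel_p = p^k`, `k ≤ 1 < rank + 2` with `rank = r_an = 0`
by GZK; `X11b.noPTorsion_of_card_selmerGroup_lt_of_casselsTate`). This is how a Selmer COUNT on the rank-zero Heegner twist — e.g. the φ-descent socket
`#Sel_p ≤ #Hom_•(θ_S)·#Hom_•'(θ_Q)` (w2 g9 / w7 g3) at a member with unit class factor, where one factor is `1` and the other `≤ p` — discharges the binder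
`Ш(Wd)[p] = 0` of §1–§3. [cite: Cassels1962ArithmeticIV] [cite: SilvermanAEC2009, Thm X.4.14 and Thm X.4.2] -/
theorem noPTorsion_of_natCard_selmerGroup_le_of_analyticRank_zero (W : WeierstrassCurve ℚ) [W.IsElliptic] (p : ℕ) [hp : Fact p.Prime]
    (hCT : exists_casselsTate_pairing (K := ℚ)) (hGZK : rank_eq_analyticRank_of_analyticRank_le_one) (hr : W.analyticRank = 0)
    (hcard : Nat.card (W.selmerGroup (p : ℤ)) ≤ p) : ∀ x : W.sha, (p : ℤ) • x = 0 → x = 0 := by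
  obtain ⟨hrank, hfin⟩ := hGZK W (by rw [hr]; exact zero_le_one)
  haveI : Finite W.sha := hfin
  obtain ⟨k, hk⟩ := exists_natCard_selmerGroup_eq_pow W p
  have hk1 : k ≤ 1 := by
    rw [hk] at hcard
    exact (Nat.pow_le_pow_iff_right hp.out.one_lt).mp (by simpa only [pow_one] using hcard)
  exact X11b.noPTorsion_of_card_selmerGroup_lt_of_casselsTate W hCT p hk (by rw [hrank, hr]; omega)

/-- **PRIMITIVITY SOCKET, both branch binders in Selmer-language.** The class form of §2 with `#Sel^{(p)}(W/ℚ) ≤ p²` (rank one) and `#Sel^{(p)}(Wd/ℚ) ≤ p`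
(the rank-zero twist; `r_an(Wd) = 0` from `L(W^{(d_K)},1) ≠ 0`) in place of `Ш(W)[p] = 0`, `Ш(Wd)[p] = 0`, granting Cassels–Tate (`hCT`):
`ord_p [W(K):ℤP] = v_p(c)` ⟹ `BSD_p(W)`. [cite: Cassels1962ArithmeticIV] [cite: GrossZagier1986, Thm. I.(6.3) and V.§2 (pp. 310–312)] [cite: BurungaleFlach2024, Thm. 1.1 and Cor. 2] -/
theorem bsdp_cmRamified_of_heegnerIndex_of_natCard_selmerGroup_le_pair {p : ℕ} [hp : Fact p.Prime]
    (hGZ : ∀ (N : ℕ) [NeZero N] (W : WeierstrassCurve ℚ) (K : Type) [Field K] [NumberField K], gross_zagier N W K)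
    (hKo : ∀ (N : ℕ) [NeZero N] (W : WeierstrassCurve ℚ) (K : Type) [Field K] [NumberField K], kolyvagin N W K)
    (hGZK : rank_eq_analyticRank_of_analyticRank_le_one) (hmod : hasEntireLFunction_rat) (hGZ73 : GrossZagier1986_thm_I_7_3)
    (hCT : exists_casselsTate_pairing (K := ℚ))
    (W : WeierstrassCurve ℚ) [W.IsElliptic] [W.IsGloballyMinimal] (hCM : W.HasCM) (hram : CMRamified W p) (h5 : 5 ≤ p)
    (hr : W.analyticRank = 1)
    (N : ℕ) [NeZero N] (K : Type) [Field K] [NumberField K]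
    (Dt : ModularParametrizationData W N) (H : HeegnerDatum N (NumberField.discr K)) (ι : K →+* ℂ)
    (P : (W.baseChange K).toAffine.Point) (Wd : WeierstrassCurve ℚ) [Wd.IsElliptic] [Wd.IsGloballyMinimal]
    (hN : W.conductorNorm ℤ = N) (hK : IsImaginaryQuadratic K) (hHN : SatisfiesHeegnerHypothesis N K)
    (hodd : Odd (NumberField.discr K)) (hd4 : NumberField.discr K < -4)
    (hLt : (W.quadraticTwist (NumberField.discr K : ℚ)).entireLFunction 1 ≠ 0)
    (hP : WeierstrassCurve.Affine.Point.map ι.toRatAlgHom P = heegnerPointComplex Dt H)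
    (hC : ∃ C : VariableChange ℚ, C • W.quadraticTwist (NumberField.discr K : ℚ) = Wd)
    (hsel : Nat.card (W.selmerGroup (p : ℤ)) ≤ p ^ 2) (hseld : Nat.card (Wd.selmerGroup (p : ℤ)) ≤ p)
    (hidx : padicValNat p (AddSubgroup.zmultiples P).index = padicValNat p Dt.c.natAbs) (hWd : BSDp Wd p) :
    BSDp W p := by
  obtain ⟨Cd, hCd⟩ := hC
  have hD0 : (NumberField.discr K : ℚ) ≠ 0 := by exact_mod_cast NumberField.discr_ne_zero K
  haveI : (W.quadraticTwist (NumberField.discr K : ℚ)).IsElliptic := W.isElliptic_quadraticTwist hD0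
  have hLd1 : Wd.entireLFunction 1 ≠ 0 := by rw [← hCd, entireLFunction_smul]; exact hLt
  have hrd : Wd.analyticRank = 0 := analyticRank_eq_zero_of_entireLFunction_one_ne_zero Wd hLd1
  have h0d : ∀ x : Wd.sha, (p : ℤ) • x = 0 → x = 0 :=
    noPTorsion_of_natCard_selmerGroup_le_of_analyticRank_zero Wd p hCT hGZK hrd hseld
  exact bsdp_cmRamified_of_heegnerIndex_of_natCard_selmerGroup_le_sq hGZ hKo hGZK hmod hGZ73 hCT W hCM hram h5 hr N K Dt H ι P Wd hN hK hHN
    hodd hd4 hLt hP ⟨Cd, hCd⟩ hsel h0d hidx hWd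

end Summit.BirchSwinnertonDyer.BirchSwinnertonDyer.Theorems.PrintCFram.ParitySplit

end
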